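import Summits.QuantumFields.YangMills.Theses.LangevinControlUV
import Summits.QuantumFields.YangMills.Theorems.LangevinControlUVGapToContinuumStubDiagBoundToGap

/-!
# Skeleton of line `SketchIdeator5` for crux `GapToContinuum` (stmt-QuantumFields-8896), lead c2

Reshaped from round-2 ideator 5's evidence file (`Cruxes/GapToContinuum/SketchIdeator5.lean`: scheme
reindexing + the sign-definite normal form) into an ELIGIBLE skeleton, composed with lead a1's landed
continuum-side reduction L1 (`stub_diagBoundToGap`, p125787; Literature
`OSData.hasMassGap_of_diagBound`).  The composition is an exact reduction of the typed crux to ONE stub: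

* `stub_signDefiniteCore` — for schemes whose couplings have ONE sign for ALL `k`
  (`∀ k, 0 ≤ β_k`, where odd-torus reflection positivity is available at every step, or
  `∀ k, β_k < 0`), `IsYangMillsFor r sch T` and `HasLatticeMassGap r sch Δ` give the DIAGONAL
  exponential bound of `T` with a FREE constant on every single slab-ordered real product tensor.
  By `gapToContinuum_iff_diagonalCore` (p125787) and `gapToContinuum_iff_signDefinite` (ideator 5,
  re-proved below as `GapToContinuum_of`) this stub is EQUIVALENT to the typed crux; it inherits
  D2 (per-pair thresholds `∀ A B ∃ C ∀ᶠ k` vs the `k`-growing family of translated product pairs)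
  and D3(b) (absolute per-pair constants vs renormalised composites on the own time-periodic tori)
  verbatim — see `Lines/*dead*.md` of leads -0, c1, a1 and the standing `Disproof.lean`.

`GapToContinuum_of` concludes the crux BY NAME: reindex the scheme along `Nat.nth {k | 0 ≤ β_k}`
(if that set is infinite) or shift past its maximum (otherwise) — `T`, `Δ` and both hypotheses are
stable under reindexing — then apply the stub and L1.
-/

noncomputable section

namespace Summit.QuantumFields.YangMills.Cruxes.GapToContinuum.SketchIdeator5

open scoped SchwartzMap
open Filter Topology
open Literature.MathematicalPhysics.AQFT Literature.MathematicalPhysics.QuantumLattice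
open Literature.MathematicalPhysics.QuantumFieldTheory
open Summit.QuantumFields.YangMills.Theses.LangevinControlUV

variable {ι : Type} {G : Type} [Group G] [TopologicalSpace G] [IsTopologicalGroup G] [CompactSpace G]
  [MeasurableSpace G] [BorelSpace G]

/-! ## §0 Reindexing a scheme (adapted from ideator 5's `SpeciesScheme.reindex`) -/

/-- Reindexing a scheme along `φ : ℕ → ℕ` with `φ → ∞`: spacings, couplings, volumes and
renormalisations are read at `φ k`. -/
def reindex (sch : SpeciesScheme ι) (φ : ℕ → ℕ) (hφ : Tendsto φ atTop atTop) : SpeciesScheme ι where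
  a := fun k => sch.a (φ k)
  a_pos := fun k => sch.a_pos (φ k)
  tendsto_a := sch.tendsto_a.comp hφ
  β := fun k => sch.β (φ k)
  L := fun k => sch.L (φ k)
  tendsto_L := sch.tendsto_L.comp hφ
  c := fun s k => sch.c s (φ k)
  m := fun s k => sch.m s (φ k)

/-- `IsYangMillsFor` is stable under reindexing (same `T`). -/
theorem isYangMillsFor_reindex {r : LatticeRep G} {sch : SpeciesScheme (YMSpecies G)}
    {T : OSData (YMSpecies G) 4} (h : IsYangMillsFor r sch T) (φ : ℕ → ℕ)
    (hφ : Tendsto φ atTop atTop) : IsYangMillsFor r (reindex sch φ hφ) T := by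
  intro n hn σ f F hF hoff
  exact (h n hn σ f F hF hoff).comp hφ

/-- `HasLatticeMassGap` is stable under reindexing (same `Δ`, same per-pair constants). -/
theorem hasLatticeMassGap_reindex {r : LatticeRep G} {sch : SpeciesScheme ι} {Δ : ℝ}
    (h : HasLatticeMassGap r sch Δ) (φ : ℕ → ℕ) (hφ : Tendsto φ atTop atTop) :
    HasLatticeMassGap r (reindex sch φ hφ) Δ := by
  intro A B
  obtain ⟨C, hC⟩ := h A B
  exact ⟨C, hφ.eventually hC⟩

/-! ## §1 The stub -/

/-- **Stub (sign-definite diagonal core) — OPEN.**  For schemes whose couplings have one sign for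
all `k`, the Yang–Mills identification and the per-pair lattice mass gap give the diagonal
exponential bound of `T`, with a free constant, on every slab-ordered real product tensor.
Equivalent to the typed crux (`gapToContinuum_iff_diagonalCore` + the sign-definite normal form);
inherits D2/D3(b). -/
theorem stub_signDefiniteCore :
    ∀ (G : Type) [Group G] [TopologicalSpace G] [IsTopologicalGroup G] [CompactSpace G]
      [MeasurableSpace G] [BorelSpace G] (r : LatticeRep G) (sch : SpeciesScheme (YMSpecies G))
      (T : OSData (YMSpecies G) 4) (Δ : ℝ), 0 < Δ →
        ((∀ k, 0 ≤ sch.β k) ∨ (∀ k, sch.β k < 0)) →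
        IsYangMillsFor r sch T → HasLatticeMassGap r sch Δ →
        ∀ (n : ℕ), n ≠ 0 → ∀ (k : Fin n → YMSpecies G)
          (P : 𝓢((Fin n → EuclideanSpace ℝ (Fin 4)), ℂ)),
          P ∈ slabOrderedProducts 4 n → ∃ C : ℝ, ∀ t : ℝ, 0 ≤ t →
            ‖T.schwinger (n + n) (Fin.append (k ∘ Fin.rev) k)
                  ((osAdjoint P).appendTensor (translateMulti (EuclideanSpace.single 0 t) P)) -
                T.schwinger n (k ∘ Fin.rev) (osAdjoint P) * T.schwinger n k P‖ ≤
              C * Real.exp (-Δ * t) := by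
  sorry

/-! ## §2 Composition -/

/-- **Composition**: the stub gives the crux by name (sign-definite normal form by reindexing, then
the landed continuum reduction L1 `stub_diagBoundToGap`). -/
theorem GapToContinuum_of :
    Summit.QuantumFields.YangMills.Theses.LangevinControlUV.GapToContinuum := by
  intro G _ _ _ _ _ _ r sch T Δ hΔ hYM hlat
  refine Summit.QuantumFields.YangMills.Theorems.GapToContinuum.SketchIdeator4.stub_diagBoundToGap
    (YMSpecies G) 4 (by norm_num) T Δ ?_
  by_cases hinf : {k | 0 ≤ sch.β k}.Infinite
  · have hφm : StrictMono (Nat.nth fun k => 0 ≤ sch.β k) := Nat.nth_strictMono hinf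
    have hφ : Tendsto (Nat.nth fun k => 0 ≤ sch.β k) atTop atTop := hφm.tendsto_atTop
    have hmem : ∀ k, 0 ≤ (reindex sch _ hφ).β k := fun k => Nat.nth_mem_of_infinite hinf k
    exact stub_signDefiniteCore G r (reindex sch _ hφ) T Δ hΔ (Or.inl hmem)
      (isYangMillsFor_reindex hYM _ hφ) (hasLatticeMassGap_reindex hlat _ hφ)
  · have hfin : {k | 0 ≤ sch.β k}.Finite := Set.not_infinite.mp hinf
    obtain ⟨k₁, hk₁⟩ := hfin.bddAbove
    have hφ : Tendsto (fun k => k + (k₁ + 1)) atTop atTop := tendsto_add_atTop_nat (k₁ + 1)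
    have hmem : ∀ k, (reindex sch _ hφ).β k < 0 := fun k => by
      by_contra hc
      have hle : k + (k₁ + 1) ≤ k₁ :=
        hk₁ (show k + (k₁ + 1) ∈ {k | 0 ≤ sch.β k} from not_lt.mp hc)
      omega
    exact stub_signDefiniteCore G r (reindex sch _ hφ) T Δ hΔ (Or.inr hmem)
      (isYangMillsFor_reindex hYM _ hφ) (hasLatticeMassGap_reindex hlat _ hφ)

end Summit.QuantumFields.YangMills.Cruxes.GapToContinuum.SketchIdeator5

end
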